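import Literature.Computability.Learning.ParamsP
import Literature.Computability.Learning.PAC
import HarnessLib

/-!
# The `AC⁰[p]` learner: the membership-query plan and its code

Machine-layer groundwork for the named fact `Literature.Computability.Learning.cikk_learn_AC0Mod`
(CIKK 2016, Cor. 5.4): WHICH points the learner asks the membership oracle about, as a typed plan
and as the query function `Q` of a truth-table transducer `ttFnAlg Q q G` (`Q ⟨x, 1ⁱ⟩ = true :: yᵢ`).

For coins `r` the learner processes the levels `ℓ < nLvlsP n a b |r|`; level `ℓ` asks, for each
of its `Reps` runs (coin segment `seg`), the `L² · 2Tk` points of the pattern inputs of the NW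
tables (`TablesPFP.patInputN`), the `2Tk` points of the vN filler blocks and the `k` points of the
DP tuple (`runQueriesN`, in the answer layout of `HypPFP`/`TablesPFP`), and then its `M`
validation points (`lvlQueriesN`); `allQueriesN` lists everything in order, `queryAtN i` is the
`i`-th query (a default point beyond the end), and `qPFn` is the query function, in `FP`
(`qPFn_apply`). The answer bookkeeping (`qoffP`, `runAnsN`, and the three correctness facts of a
run's answers under the true answers: `answersOKP_runAns`, `fillerAns_eq`, `dpAns_eq`) is what the
selection stage and the analysis consume.

## References

* M. Carmosino, R. Impagliazzo, V. Kabanets, A. Kolokolova, *Learning algorithms from natural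
  proofs*, CCC 2016, §5 (complete algorithm: membership queries) [CarmosinoImpagliazzoKabanetsKolokolova2016].
* M. Kearns, U. Vazirani, *An Introduction to Computational Learning Theory*, MIT Press 1994, §8.1 [KearnsVazirani1994].
-/

open Polynomial

namespace Literature.Computability.Learning

namespace Modp

open Literature.Computability.Complexity Literature.Computability.Complexity.GaussRank
  Literature.Computability.Cryptography Literature.Computability.MetaComplexity _root_.Computability CodeFP Finset

variable [P : PrimeP]

/-! ### The typed plan -/

section Plan

/-- Point `m < 2Tk` of an input string `u` of `2T` blocks: block `m / k`, point `m % k`. [folklore] -/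
def ptOf (n k β : ℕ) (u : List Bool) (m : ℕ) : List Bool := sl u (m / k * (k * n + k * β) + m % k * n) n

variable (π : PrmT) (seg : List Bool)

/-- The table queries of a run: the points of the pattern inputs, entry `(j, c)` at `(jL + c) · 2Tk`. [folklore] -/
def tableQsN : List (List Bool) :=
  (((List.range π.L).map fun j => ((List.range π.L).map fun c => (List.range (π.T * 2 * π.k)).map fun m =>
    ptOf π.n π.k π.β (patInputN π.Q π.ℓ π.N (sl seg 0 π.ℓ) (sl seg (offZ π.ℓ) (π.Q * π.Q)) j c) m).flatten)).flatten

/-- The filler queries of a run: the `2Tk` points of the vN filler blocks. [folklore] -/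
def fillerQsN : List (List Bool) := (List.range (π.T * 2 * π.k)).map fun m => ptOf π.n π.k π.β (sl seg (offFil π.ℓ π.Q π.L π.τ) π.N) m

/-- The DP queries of a run: the `k` points of the tuple. [folklore] -/
def dpQsN : List (List Bool) := (List.range π.k).map fun i => sl seg (offTup π.n π.k π.β π.T π.ℓ π.Q π.L π.kk π.τ + i * (π.n + π.β)) π.n

/-- **The membership queries of one run.** [cite: CarmosinoImpagliazzoKabanetsKolokolova2016, §5 (steps 2–5)] -/
def runQueriesN : List (List Bool) := tableQsN π seg ++ fillerQsN π seg ++ dpQsN π seg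

variable (n a b : ℕ) (r : List Bool)

/-- The coin segment of run `ρ` of level `ℓ`. [folklore] -/
def lvlSegP (ℓ ρ : ℕ) : List Bool := sl r (lvlCoffP n a b ℓ + ρ * lvlSlotP n a b ℓ) (lvlRunLenP n a b ℓ)

/-- The validation point `w` of level `ℓ`. [folklore] -/
def lvlValPtP (ℓ w : ℕ) : List Bool := sl r (lvlCoffP n a b ℓ + RepsP n a b ℓ * lvlSlotP n a b ℓ + w * n) n

/-- **The queries of level `ℓ`**: its runs, then its validation points. [folklore] -/
def lvlQueriesN (ℓ : ℕ) : List (List Bool) :=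
  ((List.range (RepsP n a b ℓ)).map fun ρ => runQueriesN (prmLvl n a b ℓ) (lvlSegP n a b r ℓ ρ)).flatten ++
    (List.range (MP n a b ℓ)).map fun w => lvlValPtP n a b r ℓ w

/-- The number of processed levels. [folklore] -/
def nLvlsP (R : ℕ) : ℕ := ((List.range (R + 1)).filter fun ℓ => decide (lvlCoffP n a b (ℓ + 1) ≤ R)).length

/-- **All queries**, in order. [folklore] -/
def allQueriesN : List (List Bool) := ((List.range (nLvlsP n a b r.length)).map (lvlQueriesN n a b r)).flatten

/-- **Query `i`** (the all-false point beyond the end). [folklore] -/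
def queryAtN (i : ℕ) : List Bool := (allQueriesN n a b r).getD i (List.replicate n false)

/-- The number of queries of level `ℓ`. [folklore] -/
def lvlNQP (ℓ : ℕ) : ℕ := RepsP n a b ℓ * nQRunP n a b ℓ + MP n a b ℓ

/-- The offset of the answers of level `ℓ`. [folklore] -/
def qoffP (ℓ : ℕ) : ℕ := ∑ ℓ' ∈ Finset.range ℓ, lvlNQP n a b ℓ'

/-- The total number of queries. [folklore] -/
def totalNQP : ℕ := qoffP n a b (nLvlsP n a b r.length)

end Plan

/-! ### Lengths -/

section Lengths

variable (π : PrmT) (seg : List Bool) (n a b : ℕ) (r : List Bool)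

omit P in
/-- A slice has its nominal length. [folklore] -/
@[simp] theorem length_sl (s : List Bool) (o len : ℕ) : (sl s o len).length = len := by rw [sl, List.takeD_length]

omit P in
/-- A point has `n` bits. [folklore] -/
@[simp] theorem length_ptOf (n k β : ℕ) (u : List Bool) (m : ℕ) : (ptOf n k β u m).length = n := length_sl _ _ _

omit P in
/-- Flattening lists of a fixed length. [folklore] -/
theorem length_flatten_of_forall {γ : Type} {l : List (List γ)} {c : ℕ} (h : ∀ x ∈ l, x.length = c) : l.flatten.length = l.length * c := by
  induction l with
  | nil => simp
  | cons x l ih =>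
    rw [List.flatten_cons, List.length_append, h x (by simp), ih (fun y hy => h y (by simp [hy])), List.length_cons]; ring

/-- The table queries number `L² · 2Tk`. [folklore] -/
theorem length_tableQsN : (tableQsN π seg).length = π.L * π.L * (π.T * 2 * π.k) := by
  rw [tableQsN, length_flatten_of_forall (c := π.L * (π.T * 2 * π.k)), List.length_map, List.length_range]
  · ring
  · intro x hx
    obtain ⟨j, -, rfl⟩ := List.mem_map.1 hx
    rw [length_flatten_of_forall (c := π.T * 2 * π.k), List.length_map, List.length_range]
    intro y hy
    obtain ⟨c, -, rfl⟩ := List.mem_map.1 hy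
    rw [List.length_map, List.length_range]

/-- **A run asks `nQRun` queries.** [folklore] -/
theorem length_runQueriesN (ℓ : ℕ) : (runQueriesN (prmLvl n a b ℓ) seg).length = nQRunP n a b ℓ := by
  rw [runQueriesN, List.length_append, List.length_append, length_tableQsN, fillerQsN, dpQsN, List.length_map, List.length_map,
    List.length_range, List.length_range]
  rfl

/-- **Level `ℓ` asks `lvlNQ` queries.** [folklore] -/
theorem length_lvlQueriesN (ℓ : ℕ) : (lvlQueriesN n a b r ℓ).length = lvlNQP n a b ℓ := by
  rw [lvlQueriesN, List.length_append, length_flatten_of_forall (c := nQRunP n a b ℓ), List.length_map, List.length_range, List.length_map,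
    List.length_range, lvlNQP]
  intro x hx
  obtain ⟨ρ, -, rfl⟩ := List.mem_map.1 hx
  exact length_runQueriesN _ n a b ℓ

omit P in
/-- Flattening a map over a range has the summed length. [folklore] -/
theorem length_flatten_map_range {γ : Type} (F : ℕ → List γ) (m : ℕ) :
    (((List.range m).map F).flatten).length = ∑ i ∈ Finset.range m, (F i).length := by
  induction m with
  | zero => simp
  | succ m ih => rw [List.range_succ, List.map_append, List.flatten_append, List.length_append, ih, Finset.sum_range_succ]; simp

/-- **The total number of queries.** [folklore] -/
theorem length_allQueriesN : (allQueriesN n a b r).length = totalNQP n a b r := by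
  rw [allQueriesN, length_flatten_map_range, totalNQP, qoffP]
  exact Finset.sum_congr rfl fun ℓ _ => length_lvlQueriesN n a b r ℓ

/-- Every query has `n` bits. [folklore] -/
theorem length_of_mem_runQueriesN {ℓ : ℕ} {x : List Bool} (hx : x ∈ runQueriesN (prmLvl n a b ℓ) seg) : x.length = n := by
  rw [runQueriesN, List.mem_append, List.mem_append] at hx
  rcases hx with (h | h) | h
  · rw [tableQsN, List.mem_flatten] at h
    obtain ⟨l1, hl1, h1⟩ := h
    obtain ⟨j, -, rfl⟩ := List.mem_map.1 hl1
    obtain ⟨l2, hl2, h2⟩ := List.mem_flatten.1 h1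
    obtain ⟨c, -, rfl⟩ := List.mem_map.1 hl2
    obtain ⟨m, -, rfl⟩ := List.mem_map.1 h2
    exact length_ptOf _ _ _ _ _
  · obtain ⟨m, -, rfl⟩ := List.mem_map.1 h; exact length_ptOf _ _ _ _ _
  · obtain ⟨i, -, rfl⟩ := List.mem_map.1 h; exact length_sl _ _ _

/-- Every query has `n` bits. [folklore] -/
theorem length_of_mem_allQueriesN {x : List Bool} (hx : x ∈ allQueriesN n a b r) : x.length = n := by
  rw [allQueriesN, List.mem_flatten] at hx
  obtain ⟨l, hl, hx⟩ := hx
  obtain ⟨ℓ, -, rfl⟩ := List.mem_map.1 hl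
  rw [lvlQueriesN, List.mem_append, List.mem_flatten] at hx
  rcases hx with ⟨l', hl', hx⟩ | hx
  · obtain ⟨ρ, -, rfl⟩ := List.mem_map.1 hl'
    exact length_of_mem_runQueriesN _ n a b hx
  · obtain ⟨w, -, rfl⟩ := List.mem_map.1 hx; exact length_sl _ _ _

/-- **Every query has `n` bits.** [folklore] -/
theorem length_queryAtN (i : ℕ) : (queryAtN n a b r i).length = n := by
  rw [queryAtN, List.getD_eq_getElem?_getD]
  cases h : (allQueriesN n a b r)[i]? with
  | none => simp
  | some x => exact length_of_mem_allQueriesN n a b r (List.mem_of_getElem? h)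

end Lengths

/-! ### Which levels are processed -/

section Levels

variable (n a b : ℕ)

/-- **The processed levels are the levels below `nLvls`.** [folklore] -/
theorem processed_iff_lt_nLvlsP (R ℓ : ℕ) : LvlProcessedP n a b R ℓ ↔ ℓ < nLvlsP n a b R := by
  -- the processed levels form an initial segment of `range (R+1)`
  have hseg : (List.range (R + 1)).filter (fun ℓ => decide (lvlCoffP n a b (ℓ + 1) ≤ R)) =
      List.range (((List.range (R + 1)).filter fun ℓ => decide (lvlCoffP n a b (ℓ + 1) ≤ R)).length) := by
    set c := ((List.range (R + 1)).filter fun ℓ => decide (lvlCoffP n a b (ℓ + 1) ≤ R)).length with hc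
    have hdown : ∀ ℓ ℓ', LvlProcessedP n a b R ℓ → ℓ' ≤ ℓ → LvlProcessedP n a b R ℓ' := fun ℓ ℓ' h hle => lvlProcessedP_mono n a b h hle
    -- every processed level is `< R + 1`
    have hlt : ∀ ℓ, LvlProcessedP n a b R ℓ → ℓ < R + 1 := fun ℓ h => Nat.lt_succ_of_lt (lt_of_processed n a b h)
    -- the filter of a downward-closed predicate on a range is a range
    have key : ∀ m, (∀ ℓ, LvlProcessedP n a b R ℓ → ℓ < m) →
        (List.range m).filter (fun ℓ => decide (lvlCoffP n a b (ℓ + 1) ≤ R)) =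
          List.range (((List.range m).filter fun ℓ => decide (lvlCoffP n a b (ℓ + 1) ≤ R)).length) := by
      intro m hm
      induction m with
      | zero => simp
      | succ m ih =>
        by_cases hP : LvlProcessedP n a b R m
        · -- then all `ℓ ≤ m` are processed: the filter is everything
          have hall : ∀ m' ≤ m + 1, (List.range m').filter (fun ℓ => decide (lvlCoffP n a b (ℓ + 1) ≤ R)) = List.range m' := by
            intro m' hm'
            exact List.filter_eq_self.2 fun ℓ hℓ => by
              rw [decide_eq_true_eq]; exact hdown m ℓ hP (by have := List.mem_range.1 hℓ; omega)
          rw [hall (m + 1) le_rfl, List.length_range]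
        · have hm' : ∀ ℓ, LvlProcessedP n a b R ℓ → ℓ < m := fun ℓ h => by
            have := hm ℓ h
            rcases Nat.lt_succ_iff_lt_or_eq.1 this with h' | h'
            · exact h'
            · exact absurd (h' ▸ h) hP
          rw [List.range_succ, List.filter_append, List.filter_cons_of_neg (by simpa [LvlProcessedP] using hP), List.filter_nil, List.append_nil]
          exact ih hm'
    exact key (R + 1) hlt
  constructor
  · intro h
    have hmem : ℓ ∈ (List.range (R + 1)).filter (fun ℓ => decide (lvlCoffP n a b (ℓ + 1) ≤ R)) :=
      List.mem_filter.2 ⟨List.mem_range.2 (Nat.lt_succ_of_lt (lt_of_processed n a b h)), by simpa [LvlProcessedP] using h⟩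
    rw [hseg] at hmem
    exact List.mem_range.1 hmem
  · intro h
    have hmem : ℓ ∈ List.range (nLvlsP n a b R) := List.mem_range.2 h
    rw [nLvlsP, ← hseg] at hmem
    simpa [LvlProcessedP] using (List.mem_filter.1 hmem).2

end Levels

/-! ### The answers of a run -/

section Answers

variable (n a b : ℕ) (r : List Bool) (f : (Fin n → Bool) → Bool)

/-- **The true answers** to the first `q` queries. [folklore] -/
def ansListP (q : ℕ) : List Bool := List.ofFn fun i : Fin q => f (rdBits (queryAtN n a b r i) 0 n)

/-- The answers of run `ρ` of level `ℓ` inside an answer string. [folklore] -/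
def runAnsN (ans : List Bool) (ℓ ρ : ℕ) : List Bool := sl ans (qoffP n a b ℓ + ρ * nQRunP n a b ℓ) (nQRunP n a b ℓ)

/-- The validation answer `w` of level `ℓ`. [folklore] -/
def valAnsN (ans : List Bool) (ℓ w : ℕ) : Bool := ans.getD (qoffP n a b ℓ + RepsP n a b ℓ * nQRunP n a b ℓ + w) false

omit P in
/-- Reading inside a flattened map over a range. [folklore] -/
theorem getD_flatten_map_range {γ : Type} (F : ℕ → List γ) {c : ℕ} (hF : ∀ i, (F i).length = c) (m : ℕ) {i j : ℕ} (hi : i < m)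
    (hj : j < c) (d : γ) : (((List.range m).map F).flatten).getD (i * c + j) d = (F i).getD j d := by
  induction m with
  | zero => exact absurd hi (Nat.not_lt_zero _)
  | succ m ih =>
    rw [List.range_succ, List.map_append, List.flatten_append, List.map_singleton, List.flatten_singleton, List.getD_eq_getElem?_getD,
      List.getD_eq_getElem?_getD]
    have hlen : (((List.range m).map F).flatten).length = m * c := by
      rw [length_flatten_map_range, Finset.sum_congr rfl fun i _ => hF i, Finset.sum_const, Finset.card_range, smul_eq_mul]
    rcases Nat.lt_succ_iff_lt_or_eq.1 hi with h | rfl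
    · rw [List.getElem?_append_left (by rw [hlen]; nlinarith), ← List.getD_eq_getElem?_getD, ih h, List.getD_eq_getElem?_getD]
    · rw [List.getElem?_append_right (by rw [hlen]; omega), hlen, show i * c + j - i * c = j by omega]

omit P in
/-- Reading inside a flattened map over a range with summed lengths. [folklore] -/
theorem getD_flatten_map_range_sum {γ : Type} (F : ℕ → List γ) (m : ℕ) {i j : ℕ} (hi : i < m) (hj : j < (F i).length) (d : γ) :
    (((List.range m).map F).flatten).getD (∑ i' ∈ Finset.range i, (F i').length + j) d = (F i).getD j d := by
  induction m with
  | zero => exact absurd hi (Nat.not_lt_zero _)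
  | succ m ih =>
    rw [List.range_succ, List.map_append, List.flatten_append, List.map_singleton, List.flatten_singleton, List.getD_eq_getElem?_getD,
      List.getD_eq_getElem?_getD]
    have hlen : (((List.range m).map F).flatten).length = ∑ i' ∈ Finset.range m, (F i').length := length_flatten_map_range F m
    rcases Nat.lt_succ_iff_lt_or_eq.1 hi with h | rfl
    · have hle : ∑ i' ∈ Finset.range i, (F i').length + (F i).length ≤ ∑ i' ∈ Finset.range m, (F i').length := by
        rw [← Finset.sum_range_succ]
        exact Finset.sum_le_sum_of_subset (Finset.range_mono h)
      rw [List.getElem?_append_left (by rw [hlen]; omega), ← List.getD_eq_getElem?_getD, ih h, List.getD_eq_getElem?_getD]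
    · rw [List.getElem?_append_right (by rw [hlen]; omega), hlen, Nat.add_sub_cancel_left]

variable {n a b r}

/-- **Query `qoff ℓ + ρ·nQRun + m` is query `m` of run `ρ` of the processed level `ℓ`.** [folklore] -/
theorem queryAtN_run {ℓ : ℕ} (hℓ : LvlProcessedP n a b r.length ℓ) {ρ : ℕ} (hρ : ρ < RepsP n a b ℓ) {m : ℕ} (hm : m < nQRunP n a b ℓ) :
    queryAtN n a b r (qoffP n a b ℓ + ρ * nQRunP n a b ℓ + m) = (runQueriesN (prmLvl n a b ℓ) (lvlSegP n a b r ℓ ρ)).getD m [] := by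
  have hlt := (processed_iff_lt_nLvlsP n a b r.length ℓ).1 hℓ
  have hlen : ∀ ℓ', (lvlQueriesN n a b r ℓ').length = lvlNQP n a b ℓ' := length_lvlQueriesN n a b r
  rw [queryAtN, allQueriesN, qoffP, show ∑ ℓ' ∈ Finset.range ℓ, lvlNQP n a b ℓ' = ∑ ℓ' ∈ Finset.range ℓ, (lvlQueriesN n a b r ℓ').length from
    Finset.sum_congr rfl fun ℓ' _ => (hlen ℓ').symm, add_assoc,
    getD_flatten_map_range_sum _ _ hlt (by rw [hlen, lvlNQP]; nlinarith), lvlQueriesN, List.getD_eq_getElem?_getD,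
    List.getElem?_append_left (by
      rw [length_flatten_of_forall (c := nQRunP n a b ℓ) (fun x hx => by obtain ⟨ρ', -, rfl⟩ := List.mem_map.1 hx; exact length_runQueriesN _ n a b ℓ),
        List.length_map, List.length_range]; nlinarith),
    ← List.getD_eq_getElem?_getD, getD_flatten_map_range _ (fun ρ' => length_runQueriesN _ n a b ℓ) _ hρ hm]
  rw [List.getD_eq_getElem?_getD, List.getD_eq_getElem?_getD, List.getElem?_eq_getElem (by rw [length_runQueriesN]; exact hm)]
  rfl

/-- **Query `qoff ℓ + Reps·nQRun + w` is the validation point `w`.** [folklore] -/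
theorem queryAtN_val {ℓ : ℕ} (hℓ : LvlProcessedP n a b r.length ℓ) {w : ℕ} (hw : w < MP n a b ℓ) :
    queryAtN n a b r (qoffP n a b ℓ + RepsP n a b ℓ * nQRunP n a b ℓ + w) = lvlValPtP n a b r ℓ w := by
  have hlt := (processed_iff_lt_nLvlsP n a b r.length ℓ).1 hℓ
  have hlen : ∀ ℓ', (lvlQueriesN n a b r ℓ').length = lvlNQP n a b ℓ' := length_lvlQueriesN n a b r
  have hruns : (((List.range (RepsP n a b ℓ)).map fun ρ => runQueriesN (prmLvl n a b ℓ) (lvlSegP n a b r ℓ ρ)).flatten).length =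
      RepsP n a b ℓ * nQRunP n a b ℓ := by
    rw [length_flatten_of_forall (c := nQRunP n a b ℓ) (fun x hx => by obtain ⟨ρ', -, rfl⟩ := List.mem_map.1 hx; exact length_runQueriesN _ n a b ℓ),
      List.length_map, List.length_range]
  rw [queryAtN, allQueriesN, qoffP, show ∑ ℓ' ∈ Finset.range ℓ, lvlNQP n a b ℓ' = ∑ ℓ' ∈ Finset.range ℓ, (lvlQueriesN n a b r ℓ').length from
    Finset.sum_congr rfl fun ℓ' _ => (hlen ℓ').symm, add_assoc,
    getD_flatten_map_range_sum _ _ hlt (by rw [hlen, lvlNQP]; omega), lvlQueriesN, List.getD_eq_getElem?_getD,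
    List.getElem?_append_right (by rw [hruns]; omega), hruns, Nat.add_sub_cancel_left, List.getElem?_eq_getElem (by simpa using hw),
    List.getElem_map, List.getElem_range]
  rfl

/-- **The answers of a run are the answers to its queries** (enough queries answered). [folklore] -/
theorem runAnsN_eq {ℓ : ℕ} (hℓ : LvlProcessedP n a b r.length ℓ) {ρ : ℕ} (hρ : ρ < RepsP n a b ℓ) {q : ℕ}
    (hq : qoffP n a b ℓ + RepsP n a b ℓ * nQRunP n a b ℓ ≤ q) :
    runAnsN n a b (ansListP n a b r f q) ℓ ρ =
      (runQueriesN (prmLvl n a b ℓ) (lvlSegP n a b r ℓ ρ)).map fun pt => f (rdBits pt 0 n) := by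
  have hρ' : (ρ + 1) * nQRunP n a b ℓ ≤ RepsP n a b ℓ * nQRunP n a b ℓ := Nat.mul_le_mul_right _ hρ
  have hfit : qoffP n a b ℓ + ρ * nQRunP n a b ℓ + nQRunP n a b ℓ ≤ q := by rw [add_mul, one_mul] at hρ'; linarith
  have hlenA : (ansListP n a b r f q).length = q := by rw [ansListP, List.length_ofFn]
  rw [runAnsN, sl_eq_ofFn _ (by rw [hlenA]; exact hfit)]
  apply List.ext_getElem
  · rw [List.length_ofFn, List.length_map, length_runQueriesN]
  · intro m h1 h2
    rw [List.length_ofFn] at h1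
    have hm : qoffP n a b ℓ + ρ * nQRunP n a b ℓ + m < q := by linarith
    have e2 : (ansListP n a b r f q).getD (qoffP n a b ℓ + ρ * nQRunP n a b ℓ + m) false =
        f (rdBits (queryAtN n a b r (qoffP n a b ℓ + ρ * nQRunP n a b ℓ + m)) 0 n) := by
      have h := List.getD_eq_getElem (ansListP n a b r f q) false (hlenA ▸ hm)
      rw [h]
      unfold ansListP
      rw [List.getElem_ofFn]
    simp only [List.getElem_ofFn, List.getElem_map, rdBits]
    rw [e2, queryAtN_run hℓ hρ h1, List.getD_eq_getElem _ _ (by rw [length_runQueriesN]; exact h1)]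

/-- **The validation answer is `f` at the validation point.** [folklore] -/
theorem valAnsN_eq {ℓ : ℕ} (hℓ : LvlProcessedP n a b r.length ℓ) {w : ℕ} (hw : w < MP n a b ℓ) {q : ℕ} (hq : qoffP n a b ℓ + lvlNQP n a b ℓ ≤ q) :
    valAnsN n a b (ansListP n a b r f q) ℓ w = f (rdBits (lvlValPtP n a b r ℓ w) 0 n) := by
  have hi : qoffP n a b ℓ + RepsP n a b ℓ * nQRunP n a b ℓ + w < q := by unfold lvlNQP at hq; linarith
  rw [valAnsN, ansListP, List.getD_eq_getElem _ _ (by rw [List.length_ofFn]; exact hi), List.getElem_ofFn]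
  simp only
  rw [queryAtN_val hℓ hw]

end Answers

/-! ### The answers of a run are correct -/

section Correct

variable {n a b : ℕ} {r : List Bool} (f : (Fin n → Bool) → Bool)

omit P in
/-- Reading inside a slice (unconditionally, by padding). [folklore] -/
theorem getD_sl (u : List Bool) (o : ℕ) {len j : ℕ} (h : j < len) : (sl u o len).getD j false = u.getD (o + j) false := by
  rw [sl, getD_takeD _ h, List.getD_eq_getElem?_getD, List.getElem?_drop, ← List.getD_eq_getElem?_getD]

omit P in
/-- Reading a slice from its start reads the string at the offset. [folklore] -/
theorem rdBits_sl (u : List Bool) (o len : ℕ) : rdBits (sl u o len) 0 len = rdBits u o len := by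
  funext j
  rw [rdBits, rdBits, zero_add, sl, getD_takeD _ j.isLt, List.getD_eq_getElem?_getD, List.getElem?_drop, ← List.getD_eq_getElem?_getD]

omit P in
/-- **The point `m` of the string of `uf` is the point `ansOf` evaluates `f` at.** [folklore] -/
theorem f_rdBits_ptOf {n k β T : ℕ} (f : (Fin n → Bool) → Bool) (uf : Fin (T * 2 * (k * n + k * β)) → Bool) (m : Fin (T * 2 * k)) :
    f (rdBits (ptOf n k β (List.ofFn uf) m) 0 n) = ansOf f uf m := by
  rw [ptOf, rdBits_sl, ansOf]
  congr 1
  funext j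
  have hval : ((ampPIdxEquiv n k β T ((finProdFinEquiv.symm m).1, Sum.inl ((finProdFinEquiv.symm m).2, j)) : Fin _) : ℕ) =
      (m : ℕ) / k * (k * n + k * β) + (m : ℕ) % k * n + j := by
    rw [ampPIdxEquiv_eq, finProdFinEquiv_apply_val, innerEquiv_inl_val, finProdFinEquiv_symm_apply, Fin.coe_divNat, Fin.coe_modNat]; ring
  rw [rdBits, List.getD_eq_getElem _ _ (by rw [List.length_ofFn, ← hval]; exact Fin.isLt _), List.getElem_ofFn]
  congr 1
  exact Fin.ext hval.symm

omit P in
/-- Reading inside a doubly flattened map. [folklore] -/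
theorem getD_tableQs_aux {γ : Type} (G : ℕ → ℕ → ℕ → γ) (L C : ℕ) {j c m : ℕ} (hj : j < L) (hc : c < L) (hm : m < C) (d : γ) :
    ((((List.range L).map fun j => ((List.range L).map fun c => (List.range C).map fun m => G j c m).flatten)).flatten).getD
      ((j * L + c) * C + m) d = G j c m := by
  have hcC : c * C + m < L * C := by
    have : (c + 1) * C ≤ L * C := Nat.mul_le_mul_right _ hc
    rw [add_mul, one_mul] at this; omega
  rw [show (j * L + c) * C + m = j * (L * C) + (c * C + m) by ring,
    getD_flatten_map_range (fun j => ((List.range L).map fun c => (List.range C).map fun m => G j c m).flatten)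
      (fun j => by rw [length_flatten_of_forall (c := C) (fun x hx => by obtain ⟨c, -, rfl⟩ := List.mem_map.1 hx; simp), List.length_map,
        List.length_range]) L hj hcC d,
    getD_flatten_map_range (fun c => (List.range C).map fun m => G j c m) (fun c => by simp) L hc hm d,
    List.getD_eq_getElem _ _ (by simpa using hm), List.getElem_map, List.getElem_range]

/-- The fields of the level record. [folklore] -/
@[simp] theorem prmLvl_n (n a b ℓ : ℕ) : (prmLvl n a b ℓ).n = n := rfl
/-- The fields of the level record. [folklore] -/
@[simp] theorem prmLvl_k (n a b ℓ : ℕ) : (prmLvl n a b ℓ).k = kP n a b ℓ := rfl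
/-- The fields of the level record. [folklore] -/
@[simp] theorem prmLvl_β (n a b ℓ : ℕ) : (prmLvl n a b ℓ).β = βP n a b ℓ := rfl
/-- The fields of the level record. [folklore] -/
@[simp] theorem prmLvl_T (n a b ℓ : ℕ) : (prmLvl n a b ℓ).T = TP ℓ := rfl
/-- The fields of the level record. [folklore] -/
@[simp] theorem prmLvl_ℓ (n a b ℓ : ℕ) : (prmLvl n a b ℓ).ℓ = ℓ := rfl
/-- The fields of the level record. [folklore] -/
@[simp] theorem prmLvl_L (n a b ℓ : ℕ) : (prmLvl n a b ℓ).L = 2 ^ ℓ := rfl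
/-- The fields of the level record. [folklore] -/
@[simp] theorem prmLvl_Q (n a b ℓ : ℕ) : (prmLvl n a b ℓ).Q = 𝔭 ^ teP n a b ℓ := rfl
/-- The fields of the level record. [folklore] -/
@[simp] theorem prmLvl_kk (n a b ℓ : ℕ) : (prmLvl n a b ℓ).kk = kkP n a b ℓ := rfl
/-- The fields of the level record. [folklore] -/
@[simp] theorem prmLvl_τ (n a b ℓ : ℕ) : (prmLvl n a b ℓ).τ = τP ℓ := rfl
/-- The fields of the level record. [folklore] -/
@[simp] theorem prmLvl_N (n a b ℓ : ℕ) : (prmLvl n a b ℓ).N = TP ℓ * 2 * (kP n a b ℓ * n + kP n a b ℓ * βP n a b ℓ) := rfl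

omit P in
/-- Index arithmetic of the table chunks. [folklore] -/
theorem chunk_le {j c L C : ℕ} (hj : j < L) (hc : c < L) : (j * L + c) * C + C ≤ L * L * C := by
  have h1 : j * L + c + 1 ≤ L * L := by nlinarith
  have := Nat.mul_le_mul_right C h1
  rw [add_mul, one_mul] at this
  exact this

omit P in
/-- Index arithmetic of the table chunks. [folklore] -/
theorem chunk_lt {j c m L C : ℕ} (hj : j < L) (hc : c < L) (hm : m < C) : (j * L + c) * C + m < L * L * C :=
  lt_of_lt_of_le (Nat.add_lt_add_left hm _) (chunk_le hj hc)

/-- **The answers to the queries of a segment** under `f`. [folklore] -/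
def runAnsW (n a b : ℕ) (f : (Fin n → Bool) → Bool) (ℓ : ℕ) (seg : List Bool) : List Bool :=
  (runQueriesN (prmLvl n a b ℓ) seg).map fun pt => f (rdBits pt 0 n)

variable {ℓ : ℕ} (seg : List Bool)

/-- The abbreviations of a segment's coins. -/
local notation "SEG" => seg
local notation "ω" => coinsToRunP (teP n a b ℓ) ℓ n (κP n a b ℓ) (βP n a b ℓ) (τP ℓ) (kkP n a b ℓ) (tP n a b ℓ) (jB_pos_lvl n a b ℓ) seg

/-- The three parts of the run queries and their lengths. [folklore] -/
theorem runQueries_parts :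
    runQueriesN (prmLvl n a b ℓ) SEG = tableQsN (prmLvl n a b ℓ) SEG ++ fillerQsN (prmLvl n a b ℓ) SEG ++ dpQsN (prmLvl n a b ℓ) SEG ∧
    (tableQsN (prmLvl n a b ℓ) SEG).length = 2 ^ ℓ * 2 ^ ℓ * (TP ℓ * 2 * kP n a b ℓ) ∧
    (fillerQsN (prmLvl n a b ℓ) SEG).length = TP ℓ * 2 * kP n a b ℓ ∧ (dpQsN (prmLvl n a b ℓ) SEG).length = kP n a b ℓ ∧
    nQRunP n a b ℓ = 2 ^ ℓ * 2 ^ ℓ * (TP ℓ * 2 * kP n a b ℓ) + TP ℓ * 2 * kP n a b ℓ + kP n a b ℓ := by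
  refine ⟨rfl, ?_, ?_, ?_, rfl⟩
  · rw [length_tableQsN]; rfl
  · rw [fillerQsN, List.length_map, List.length_range]; rfl
  · rw [dpQsN, List.length_map, List.length_range]; rfl

/-- The offsets of a run's fields are inside its (padded) segment slices. [folklore] -/
theorem seg_offsets :
    offZ ℓ + 𝔭 ^ teP n a b ℓ * 𝔭 ^ teP n a b ℓ ≤ lvlRunLenP n a b ℓ ∧
    offFil ℓ (𝔭 ^ teP n a b ℓ) (2 ^ ℓ) (τP ℓ) + TP ℓ * 2 * (kP n a b ℓ * n + kP n a b ℓ * βP n a b ℓ) ≤ lvlRunLenP n a b ℓ := by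
  have e : lvlRunLenP n a b ℓ = offFil ℓ (𝔭 ^ teP n a b ℓ) (2 ^ ℓ) (τP ℓ) + TP ℓ * 2 * (kP n a b ℓ * n + kP n a b ℓ * βP n a b ℓ) +
      (TP ℓ * 2 * βP n a b ℓ + 2 * βP n a b ℓ + kkP n a b ℓ * kP n a b ℓ * βP n a b ℓ + kkP n a b ℓ * βP n a b ℓ + kP n a b ℓ +
        kP n a b ℓ * (n + βP n a b ℓ) + tP n a b ℓ * stepLenP n (kP n a b ℓ) (βP n a b ℓ) (κP n a b ℓ) + βP n a b ℓ) := by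
    unfold lvlRunLenP runLenP offJunk offSteps offTup offPbP offGuess offSeeds offU offLab QP; omega
  have e2 : offFil ℓ (𝔭 ^ teP n a b ℓ) (2 ^ ℓ) (τP ℓ) = offZ ℓ + 𝔭 ^ teP n a b ℓ * 𝔭 ^ teP n a b ℓ + (2 ^ ℓ + (τP ℓ + 1)) := by
    unfold offFil offM offWP; omega
  have hq2 : 0 < 2 ^ ℓ := Nat.two_pow_pos ℓ
  refine ⟨?_, ?_⟩ <;> omega

/-- The `ibits`/`zbits` slices of a segment are its coins' `i` and `z` (slices are padded, so this is
unconditional). [folklore] -/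
theorem seg_slices :
    sl SEG 0 ℓ = List.ofFn ((boolFunEquivFin ℓ).symm (ω).1.1.1.1.1) ∧
    sl SEG (offZ ℓ) (𝔭 ^ teP n a b ℓ * 𝔭 ^ teP n a b ℓ) = List.ofFn (ω).1.1.1.1.2.1 := by
  refine ⟨?_, ?_⟩
  · apply List.ext_getElem
    · rw [length_sl, List.length_ofFn]
    · intro j h1 h2
      rw [length_sl] at h1
      rw [List.getElem_ofFn, ← List.getD_eq_getElem _ false, getD_sl _ _ h1]
      show _ = (boolFunEquivFin ℓ).symm (boolFunEquivFin ℓ (rdBits SEG 0 ℓ)) ⟨j, h1⟩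
      rw [Equiv.symm_apply_apply]; rfl
  · apply List.ext_getElem
    · rw [length_sl, List.length_ofFn]
    · intro j h1 h2
      rw [length_sl] at h1
      rw [List.getElem_ofFn, ← List.getD_eq_getElem _ false, getD_sl _ _ h1]
      rfl

/-- Element `m` of the answers of a segment is `f` at query `m`. [folklore] -/
theorem runAnsW_getElem {m : ℕ} (hm : m < nQRunP n a b ℓ) :
    (runAnsW n a b f ℓ SEG)[m]'(by rw [runAnsW, List.length_map, length_runQueriesN]; exact hm) =
      f (rdBits ((runQueriesN (prmLvl n a b ℓ) SEG)[m]'(by rw [length_runQueriesN]; exact hm)) 0 n) := by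
  simp only [runAnsW, List.getElem_map]

/-- The answers of a segment have the run's number of bits. [folklore] -/
theorem length_runAnsW : (runAnsW n a b f ℓ SEG).length = nQRunP n a b ℓ := by rw [runAnsW, List.length_map, length_runQueriesN]

/-- **The table answers of a segment are correct** (`TablesPFP.AnswersOKP`). [folklore] -/
theorem answersOKP_runAnsW :
    AnswersOKP (teP_ne_zero n a b ℓ) (lvl_hn n a b ℓ) (ω).1.1.1.1.1 (ω).1.1.1.1.2.1 f (runAnsW n a b f ℓ SEG) := by
  intro j c hj hc
  obtain ⟨hparts, hTQ, hFQ, hDQ, hnq⟩ := runQueries_parts (n := n) (a := a) (b := b) (ℓ := ℓ) seg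
  obtain ⟨hsl0, hslz⟩ := seg_slices (n := n) (a := a) (b := b) (ℓ := ℓ) seg
  have hjc := chunk_le (C := TP ℓ * 2 * kP n a b ℓ) hj hc
  have hlenA := length_runAnsW (n := n) (a := a) (b := b) f (ℓ := ℓ) seg
  rw [ansSegN]
  apply List.ext_getElem
  · rw [List.length_take, List.length_drop, hlenA, List.length_ofFn, min_eq_left (by rw [hnq]; omega)]
  · intro m h1 h2
    rw [List.length_ofFn] at h2
    have hidxT := chunk_lt hj hc h2
    have hidx : (j * 2 ^ ℓ + c) * (TP ℓ * 2 * kP n a b ℓ) + m < nQRunP n a b ℓ := by rw [hnq]; omega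
    rw [List.getElem_take, List.getElem_drop, List.getElem_ofFn, runAnsW_getElem f seg hidx, ← f_rdBits_ptOf f _ ⟨m, h2⟩]
    refine congrArg (fun pt => f (rdBits pt 0 n)) ?_
    have hget : (tableQsN (prmLvl n a b ℓ) SEG).getD ((j * 2 ^ ℓ + c) * (TP ℓ * 2 * kP n a b ℓ) + m) [] =
        ptOf n (kP n a b ℓ) (βP n a b ℓ) (patInputN (𝔭 ^ teP n a b ℓ) ℓ (TP ℓ * 2 * (kP n a b ℓ * n + kP n a b ℓ * βP n a b ℓ))
          (sl SEG 0 ℓ) (sl SEG (offZ ℓ) (𝔭 ^ teP n a b ℓ * 𝔭 ^ teP n a b ℓ)) j c) m := by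
      have := getD_tableQs_aux (fun j c m => ptOf n (kP n a b ℓ) (βP n a b ℓ)
        (patInputN (𝔭 ^ teP n a b ℓ) ℓ (TP ℓ * 2 * (kP n a b ℓ * n + kP n a b ℓ * βP n a b ℓ)) (sl SEG 0 ℓ)
          (sl SEG (offZ ℓ) (𝔭 ^ teP n a b ℓ * 𝔭 ^ teP n a b ℓ)) j c) m) (2 ^ ℓ) (TP ℓ * 2 * kP n a b ℓ) hj hc h2 []
      simpa only [tableQsN, prmLvl_n, prmLvl_k, prmLvl_β, prmLvl_T, prmLvl_ℓ, prmLvl_L, prmLvl_Q, prmLvl_N] using this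
    rw [hsl0, hslz, patInputN_eq (teP_ne_zero n a b ℓ) (lvl_hn n a b ℓ) _ _ hj] at hget
    have hA : (j * 2 ^ ℓ + c) * (TP ℓ * 2 * kP n a b ℓ) + m < (tableQsN (prmLvl n a b ℓ) SEG ++ fillerQsN (prmLvl n a b ℓ) SEG).length := by
      rw [List.length_append, hTQ]; omega
    have hB : (j * 2 ^ ℓ + c) * (TP ℓ * 2 * kP n a b ℓ) + m < (tableQsN (prmLvl n a b ℓ) SEG).length := by rw [hTQ]; exact hidxT
    have hRQ : (runQueriesN (prmLvl n a b ℓ) SEG)[(j * 2 ^ ℓ + c) * (TP ℓ * 2 * kP n a b ℓ) + m]'(by rw [length_runQueriesN]; exact hidx) =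
        (tableQsN (prmLvl n a b ℓ) SEG)[(j * 2 ^ ℓ + c) * (TP ℓ * 2 * kP n a b ℓ) + m]'hB := by
      simp only [hparts, List.getElem_append_left hA, List.getElem_append_left hB]
    rw [hRQ, ← hget, List.getD_eq_getElem _ _ hB]

/-- **The filler answers of a segment are correct.** [folklore] -/
theorem fillerAnsW_eq :
    sl (runAnsW n a b f ℓ SEG) (ansOffFil (prmLvl n a b ℓ)) (TP ℓ * 2 * kP n a b ℓ) =
      List.ofFn (ansOf f (rdBits SEG (offFil ℓ (𝔭 ^ teP n a b ℓ) (2 ^ ℓ) (τP ℓ)) (TP ℓ * 2 * (kP n a b ℓ * n + kP n a b ℓ * βP n a b ℓ)))) := by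
  obtain ⟨hparts, hTQ, hFQ, hDQ, hnq⟩ := runQueries_parts (n := n) (a := a) (b := b) (ℓ := ℓ) seg
  have hoff : ansOffFil (prmLvl n a b ℓ) = 2 ^ ℓ * 2 ^ ℓ * (TP ℓ * 2 * kP n a b ℓ) := rfl
  have hfil : sl SEG (offFil ℓ (𝔭 ^ teP n a b ℓ) (2 ^ ℓ) (τP ℓ)) (TP ℓ * 2 * (kP n a b ℓ * n + kP n a b ℓ * βP n a b ℓ)) =
      List.ofFn (rdBits SEG (offFil ℓ (𝔭 ^ teP n a b ℓ) (2 ^ ℓ) (τP ℓ)) (TP ℓ * 2 * (kP n a b ℓ * n + kP n a b ℓ * βP n a b ℓ))) := by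
    apply List.ext_getElem
    · rw [length_sl, List.length_ofFn]
    · intro j h1 h2
      rw [length_sl] at h1
      rw [List.getElem_ofFn, ← List.getD_eq_getElem _ false, getD_sl _ _ h1]; rfl
  have hlenA := length_runAnsW (n := n) (a := a) (b := b) f (ℓ := ℓ) seg
  rw [sl_eq_ofFn _ (by rw [hlenA, hoff, hnq]; omega)]
  refine congrArg List.ofFn (funext fun m => ?_)
  have hm := m.isLt
  have hidx : 2 ^ ℓ * 2 ^ ℓ * (TP ℓ * 2 * kP n a b ℓ) + m < nQRunP n a b ℓ := by rw [hnq]; omega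
  rw [← f_rdBits_ptOf f _ m, ← hfil, rdBits, hoff, List.getD_eq_getElem _ _ (by rw [hlenA]; exact hidx), runAnsW_getElem f seg hidx]
  refine congrArg (fun pt => f (rdBits pt 0 n)) ?_
  have hA : 2 ^ ℓ * 2 ^ ℓ * (TP ℓ * 2 * kP n a b ℓ) + (m : ℕ) < (tableQsN (prmLvl n a b ℓ) SEG ++ fillerQsN (prmLvl n a b ℓ) SEG).length := by
    rw [List.length_append, hTQ, hFQ]; omega
  have hB : (tableQsN (prmLvl n a b ℓ) SEG).length ≤ 2 ^ ℓ * 2 ^ ℓ * (TP ℓ * 2 * kP n a b ℓ) + (m : ℕ) := by rw [hTQ]; omega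
  simp only [hparts, List.getElem_append_left hA, List.getElem_append_right hB]
  simp only [fillerQsN, List.getElem_map, List.getElem_range, hTQ, Nat.add_sub_cancel_left, prmLvl_n, prmLvl_k, prmLvl_β, prmLvl_T, prmLvl_ℓ,
    prmLvl_L, prmLvl_Q, prmLvl_τ, prmLvl_N]

/-- **The DP answers of a segment are correct.** [folklore] -/
theorem dpAnsW_eq :
    sl (runAnsW n a b f ℓ SEG) (ansOffTup (prmLvl n a b ℓ)) (kP n a b ℓ) = List.ofFn (fJ (p := 𝔭) (β := βP n a b ℓ) f ∘ (ω).1.2.2.1) := by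
  obtain ⟨hparts, hTQ, hFQ, hDQ, hnq⟩ := runQueries_parts (n := n) (a := a) (b := b) (ℓ := ℓ) seg
  have hoff : ansOffTup (prmLvl n a b ℓ) = 2 ^ ℓ * 2 ^ ℓ * (TP ℓ * 2 * kP n a b ℓ) + TP ℓ * 2 * kP n a b ℓ := rfl
  have hlenA := length_runAnsW (n := n) (a := a) (b := b) f (ℓ := ℓ) seg
  rw [sl_eq_ofFn _ (by rw [hlenA, hoff, hnq])]
  refine congrArg List.ofFn (funext fun i => ?_)
  have hi := i.isLt
  have hidx : 2 ^ ℓ * 2 ^ ℓ * (TP ℓ * 2 * kP n a b ℓ) + TP ℓ * 2 * kP n a b ℓ + i < nQRunP n a b ℓ := by rw [hnq]; omega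
  rw [rdBits, hoff, List.getD_eq_getElem _ _ (by rw [hlenA]; exact hidx), runAnsW_getElem f seg hidx]
  have hB : (tableQsN (prmLvl n a b ℓ) SEG ++ fillerQsN (prmLvl n a b ℓ) SEG).length ≤
      2 ^ ℓ * 2 ^ ℓ * (TP ℓ * 2 * kP n a b ℓ) + TP ℓ * 2 * kP n a b ℓ + (i : ℕ) := by rw [List.length_append, hTQ, hFQ]; omega
  simp only [Function.comp_apply, fJ, hparts, List.getElem_append_right hB, List.length_append, hTQ, hFQ, Nat.add_sub_cancel_left, dpQsN,
    List.getElem_map, List.getElem_range, prmLvl_n, prmLvl_k, prmLvl_β, prmLvl_T, prmLvl_ℓ, prmLvl_L, prmLvl_Q, prmLvl_τ, prmLvl_kk]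
  rw [rdBits_sl]
  rfl

variable {seg} (hℓ : LvlProcessedP n a b r.length ℓ) {ρ : ℕ} (hρ : ρ < RepsP n a b ℓ) {q : ℕ}
  (hq : qoffP n a b ℓ + RepsP n a b ℓ * nQRunP n a b ℓ ≤ q)

include hℓ hρ hq in
/-- **The answers of a run of a processed level are the answers of its segment.** [folklore] -/
theorem runAnsN_eq_runAnsW : runAnsN n a b (ansListP n a b r f q) ℓ ρ = runAnsW n a b f ℓ (lvlSegP n a b r ℓ ρ) := runAnsN_eq f hℓ hρ hq

end Correct

/-! ### The run queries as a code -/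

section RunCode

variable {σ : Type} {eσ : σ → List Bool}

omit P in
/-- **`ptOf` is a code** in its (unary) parameters, string and (binary) index, given a unary bound
`N ≥` the offset. [folklore] -/
theorem ptOf_code {nn kk ββ NN : σ → ℕ} {u : σ → List Bool} {m : σ → ℕ} (hn : CodeFP eσ unE nn) (hk : CodeFP eσ unE kk) (hβ : CodeFP eσ unE ββ)
    (hN : CodeFP eσ unE NN) (hu : CodeFP eσ strE u) (hm : CodeFP eσ natE m) :
    CodeFP eσ strE (fun x => sl (u x) (min (m x / kk x * (kk x * nn x + kk x * ββ x) + m x % kk x * nn x) (NN x)) (nn x)) := by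
  have hkN : CodeFP eσ natE (fun x => kk x) := (natOfUn.comp hk).congr fun _ => rfl
  have hoff : CodeFP eσ natE (fun x => m x / kk x * (kk x * nn x + kk x * ββ x) + m x % kk x * nn x) :=
    (natAdd.comp ((natMul.comp ((natDiv.comp (hm.pair hkN)).pair (natAdd.comp ((natMul.comp (hkN.pair (natOfUn.comp hn))).pair
      (natMul.comp (hkN.pair (natOfUn.comp hβ))))))).pair (natMul.comp ((natMod.comp (hm.pair hkN)).pair (natOfUn.comp hn))))).congr fun _ => rfl
  have hoffU : CodeFP eσ unE (fun x => min (m x / kk x * (kk x * nn x + kk x * ββ x) + m x % kk x * nn x) (NN x)) :=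
    (unOfNatMin.comp (hN.pair hoff)).congr fun _ => rfl
  exact sl_code hoffU hn hu

omit P in
/-- Below `2Tk` the point offset is below `N`. [folklore] -/
theorem ptOff_le {n k β T m : ℕ} (hm : m < T * 2 * k) : m / k * (k * n + k * β) + m % k * n ≤ T * 2 * (k * n + k * β) := by
  rcases Nat.eq_zero_or_pos k with rfl | hk
  · simp at hm
  · have h1 : m / k < T * 2 := Nat.div_lt_of_lt_mul (by rwa [mul_comm] at hm)
    have h2 : m % k < k := Nat.mod_lt _ hk
    have h3 : (m / k + 1) * (k * n + k * β) ≤ T * 2 * (k * n + k * β) := Nat.mul_le_mul_right _ h1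
    have h4 : (m % k + 1) * n ≤ k * n := Nat.mul_le_mul_right _ h2
    nlinarith

omit P in
/-- `ptOf` with the bound `N` is `ptOf` for `m < 2Tk`. [folklore] -/
theorem ptOf_min {n k β T : ℕ} (u : List Bool) {m : ℕ} (hm : m < T * 2 * k) :
    sl u (min (m / k * (k * n + k * β) + m % k * n) (T * 2 * (k * n + k * β))) n = ptOf n k β u m := by
  rw [min_eq_left (ptOff_le hm), ptOf]

/-- The typed run argument `⟨π, seg⟩`. [folklore] -/
abbrev RunArgT : Type := PrmT × List Bool

/-- Its code. [folklore] -/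
abbrev runArgE : RunArgT → List Bool := pairE prmE strE

/-- **`runQueriesN` is a code** on `⟨π, seg⟩`. [cite: AroraBarak2009, §1.3] -/
theorem runQueries_code : CodeFP runArgE (rawE strE) (fun x => runQueriesN x.1 x.2) := by
  have hπ : CodeFP runArgE prmE (fun x => x.1) := fst _ _
  have hseg : CodeFP runArgE strE (fun x => x.2) := snd _ _
  have hT2k : CodeFP runArgE unE (fun x => x.1.T * 2 * x.1.k) :=
    (unMul.comp ((unMul.comp ((PrmT.T_code.comp hπ).pair (const _ 2))).pair (PrmT.k_code.comp hπ))).congr fun _ => rfl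
  -- table queries: context `⟨⟨x, j⟩, c⟩`, item `m`
  let e3 := pairE (pairE (pairE runArgE natE) natE) natE
  have hX3 : CodeFP e3 runArgE (fun q => q.1.1.1) := (fst _ _).fst'.fst'
  have hπ3 : CodeFP e3 prmE (fun q => q.1.1.1.1) := (hπ.comp hX3).congr fun _ => rfl
  have hseg3 : CodeFP e3 strE (fun q => q.1.1.1.2) := (hseg.comp hX3).congr fun _ => rfl
  have hmsk : CodeFP e3 (pairE (pairE mskE strE) (pairE natE natE))
      (fun q => (((q.1.1.1.1.Q, (q.1.1.1.1.ℓ, (sl q.1.1.1.2 0 q.1.1.1.1.ℓ, q.1.1.1.1.N))), sl q.1.1.1.2 (offZ q.1.1.1.1.ℓ) (q.1.1.1.1.Q * q.1.1.1.1.Q)),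
        (q.1.1.2, q.1.2))) :=
by
    have hM1 : CodeFP e3 mskE (fun q => (q.1.1.1.1.Q, (q.1.1.1.1.ℓ, (sl q.1.1.1.2 0 q.1.1.1.1.ℓ, q.1.1.1.1.N)))) :=
      ((PrmT.Q_code.comp hπ3).pair ((PrmT.ℓ_code.comp hπ3).pair ((sl_code (const _ 0) (PrmT.ℓ_code.comp hπ3) hseg3).pair
        (PrmT.N_code.comp hπ3)))).congr fun _ => rfl
    have hM2 : CodeFP e3 strE (fun q => sl q.1.1.1.2 (offZ q.1.1.1.1.ℓ) (q.1.1.1.1.Q * q.1.1.1.1.Q)) :=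
      sl_code (PrmT.ℓ_code.comp hπ3) (unMul.comp ((PrmT.Q_code.comp hπ3).pair (PrmT.Q_code.comp hπ3))) hseg3
    have hjc : CodeFP e3 (pairE natE natE) (fun q => (q.1.1.2, q.1.2)) := ((fst _ _).fst'.snd'.pair (fst _ _).snd').congr fun _ => rfl
    exact ((hM1.pair hM2).pair hjc).congr fun _ => rfl
  have hpat : CodeFP e3 strE (fun q => patInputN q.1.1.1.1.Q q.1.1.1.1.ℓ q.1.1.1.1.N (sl q.1.1.1.2 0 q.1.1.1.1.ℓ)
      (sl q.1.1.1.2 (offZ q.1.1.1.1.ℓ) (q.1.1.1.1.Q * q.1.1.1.1.Q)) q.1.1.2 q.1.2) := (patInputN_codeFP.comp hmsk).congr fun _ => rfl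
  have hitem : CodeFP e3 strE (fun q => sl (patInputN q.1.1.1.1.Q q.1.1.1.1.ℓ q.1.1.1.1.N (sl q.1.1.1.2 0 q.1.1.1.1.ℓ)
      (sl q.1.1.1.2 (offZ q.1.1.1.1.ℓ) (q.1.1.1.1.Q * q.1.1.1.1.Q)) q.1.1.2 q.1.2)
      (min (q.2 / q.1.1.1.1.k * (q.1.1.1.1.k * q.1.1.1.1.n + q.1.1.1.1.k * q.1.1.1.1.β) + q.2 % q.1.1.1.1.k * q.1.1.1.1.n) q.1.1.1.1.N) q.1.1.1.1.n) :=
    ptOf_code (PrmT.n_code.comp hπ3) (PrmT.k_code.comp hπ3) (PrmT.β_code.comp hπ3) (PrmT.N_code.comp hπ3) hpat (snd _ _)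
  have hrow : CodeFP (pairE (pairE runArgE natE) natE) (rawE strE) (fun s => (List.range (s.1.1.1.T * 2 * s.1.1.1.k)).map fun m =>
      ptOf s.1.1.1.n s.1.1.1.k s.1.1.1.β (patInputN s.1.1.1.Q s.1.1.1.ℓ s.1.1.1.N (sl s.1.1.2 0 s.1.1.1.ℓ)
        (sl s.1.1.2 (offZ s.1.1.1.ℓ) (s.1.1.1.Q * s.1.1.1.Q)) s.1.2 s.2) m) :=
    ((CodeFP.map hitem).comp ((CodeFP.id _).pair (urange.comp ((hT2k.comp (fst _ _).fst').congr fun _ => rfl)))).congr fun s =>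
      List.map_congr_left fun m hm => ptOf_min _ (List.mem_range.1 hm)
  have htab2 : CodeFP (pairE runArgE natE) (rawE strE) (fun s => ((List.range s.1.1.L).map fun c => (List.range (s.1.1.T * 2 * s.1.1.k)).map fun m =>
      ptOf s.1.1.n s.1.1.k s.1.1.β (patInputN s.1.1.Q s.1.1.ℓ s.1.1.N (sl s.1.2 0 s.1.1.ℓ) (sl s.1.2 (offZ s.1.1.ℓ) (s.1.1.Q * s.1.1.Q)) s.2 c) m).flatten) :=
    ((flatten strE).comp ((CodeFP.map hrow).comp ((CodeFP.id _).pair (urange.comp ((PrmT.L_code.comp (hπ.comp (fst _ _))).congr fun _ => rfl))))).congr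
      fun _ => rfl
  have htab : CodeFP runArgE (rawE strE) (fun x => tableQsN x.1 x.2) :=
    ((flatten strE).comp ((CodeFP.map htab2).comp ((CodeFP.id _).pair (urange.comp (PrmT.L_code.comp hπ))))).congr fun _ => rfl
  -- filler queries
  have hfitem : CodeFP (pairE runArgE natE) strE (fun s => sl (sl s.1.2 (offFil s.1.1.ℓ s.1.1.Q s.1.1.L s.1.1.τ) s.1.1.N)
      (min (s.2 / s.1.1.k * (s.1.1.k * s.1.1.n + s.1.1.k * s.1.1.β) + s.2 % s.1.1.k * s.1.1.n) s.1.1.N) s.1.1.n) :=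
    ptOf_code (PrmT.n_code.comp (hπ.comp (fst _ _))) (PrmT.k_code.comp (hπ.comp (fst _ _))) (PrmT.β_code.comp (hπ.comp (fst _ _)))
      (PrmT.N_code.comp (hπ.comp (fst _ _))) (sl_code (PrmT.offFil_code.comp (hπ.comp (fst _ _))) (PrmT.N_code.comp (hπ.comp (fst _ _)))
      (hseg.comp (fst _ _))) (snd _ _)
  have hfil : CodeFP runArgE (rawE strE) (fun x => fillerQsN x.1 x.2) :=
    ((CodeFP.map hfitem).comp ((CodeFP.id _).pair (urange.comp hT2k))).congr fun x => List.map_congr_left fun m hm => ptOf_min _ (List.mem_range.1 hm)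
  -- DP queries
  have hditem : CodeFP (pairE runArgE natE) strE (fun s => sl s.1.2 (offTup s.1.1.n s.1.1.k s.1.1.β s.1.1.T s.1.1.ℓ s.1.1.Q s.1.1.L s.1.1.kk s.1.1.τ +
      min s.2 s.1.1.k * (s.1.1.n + s.1.1.β)) s.1.1.n) :=
    sl_code ((unAdd.comp ((PrmT.offTup_code.comp (hπ.comp (fst _ _))).pair (unMul.comp ((uidx_code (PrmT.k_code.comp hπ)).pair
      (unAdd.comp ((PrmT.n_code.comp (hπ.comp (fst _ _))).pair (PrmT.β_code.comp (hπ.comp (fst _ _))))))))).congr fun _ => rfl)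
      (PrmT.n_code.comp (hπ.comp (fst _ _))) (hseg.comp (fst _ _))
  have hdp : CodeFP runArgE (rawE strE) (fun x => dpQsN x.1 x.2) :=
    ((CodeFP.map hditem).comp ((CodeFP.id _).pair (urange.comp (PrmT.k_code.comp hπ)))).congr fun x =>
      map_range_min x.1.k fun i => sl x.2 (offTup x.1.n x.1.k x.1.β x.1.T x.1.ℓ x.1.Q x.1.L x.1.kk x.1.τ + i * (x.1.n + x.1.β)) x.1.n
  exact ((rawAppend strE).comp (((rawAppend strE).comp (htab.pair hfil)).pair hdp)).congr fun _ => rfl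

end RunCode

/-! ### The capped level record and the level queries as codes -/

section LevelCode

variable (n a b : ℕ)

/-- The level quantities are inside the run length. [folklore] -/
theorem lvl_le_runLen (ℓ : ℕ) :
    kP n a b ℓ ≤ lvlRunLenP n a b ℓ ∧ TP ℓ ≤ lvlRunLenP n a b ℓ ∧ 2 ^ ℓ ≤ lvlRunLenP n a b ℓ ∧ QP n a b ℓ ≤ lvlRunLenP n a b ℓ ∧
    KKP n a b ℓ ≤ lvlRunLenP n a b ℓ ∧ tP n a b ℓ ≤ lvlRunLenP n a b ℓ := by
  have e : lvlRunLenP n a b ℓ = ℓ + QP n a b ℓ * QP n a b ℓ + 2 ^ ℓ + (τP ℓ + 1) + TP ℓ * 2 * (kP n a b ℓ * n + kP n a b ℓ * βP n a b ℓ) +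
      TP ℓ * 2 * βP n a b ℓ + 2 * βP n a b ℓ + kkP n a b ℓ * kP n a b ℓ * βP n a b ℓ + kkP n a b ℓ * βP n a b ℓ + kP n a b ℓ +
      kP n a b ℓ * (n + βP n a b ℓ) + tP n a b ℓ * stepLenP n (kP n a b ℓ) (βP n a b ℓ) (κP n a b ℓ) + βP n a b ℓ := by
    unfold lvlRunLenP runLenP offJunk offSteps offTup offPbP offGuess offSeeds offU offLab offFil offM offWP offZ; rfl
  have hQ : QP n a b ℓ ≤ QP n a b ℓ * QP n a b ℓ := Nat.le_mul_of_pos_left _ (Nat.one_le_pow _ _ P.prime.pos)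
  have hβ : 1 ≤ βP n a b ℓ := by unfold βP; omega
  have hT : TP ℓ ≤ TP ℓ * 2 * βP n a b ℓ := by nlinarith
  have hst : 1 ≤ stepLenP n (kP n a b ℓ) (βP n a b ℓ) (κP n a b ℓ) := by unfold stepLenP κP; omega
  have ht : tP n a b ℓ ≤ tP n a b ℓ * stepLenP n (kP n a b ℓ) (βP n a b ℓ) (κP n a b ℓ) := Nat.le_mul_of_pos_right _ hst
  have hKK : KKP n a b ℓ ≤ tP n a b ℓ := Nat.le_mul_of_pos_left _ (Nat.two_pow_pos _)
  have h2ℓ := Nat.two_pow_pos ℓ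
  omega

omit P in
/-- `2u ≤ 2^u`. [folklore] -/
theorem two_mul_le_two_pow (u : ℕ) : 2 * u ≤ 2 ^ u := by
  induction u with
  | zero => simp
  | succ u ih =>
    rcases Nat.eq_zero_or_pos u with rfl | hu
    · simp
    · have : 2 ≤ 2 ^ u := by
        calc (2 : ℕ) = 2 ^ 1 := by norm_num
          _ ≤ 2 ^ u := Nat.pow_le_pow_right (by norm_num) hu
      rw [pow_succ]; omega

/-- `1 ≤ P`. [folklore] -/
theorem one_le_PP : 1 ≤ PP := Nat.size_pos.2 P.prime.pos

/-- **The validation sample is smaller than the number of runs**: `M ≤ Reps`. [folklore] -/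
theorem MP_le_RepsP (ℓ : ℕ) : MP n a b ℓ ≤ RepsP n a b ℓ := by
  have hP := one_le_PP
  have hE : 6 * sP n a b + 20 ≤ repsExpP n a b ℓ := by
    have h1 : 3 * sP n a b + 40 ≤ kkP n a b ℓ := by unfold kkP κP; omega
    have h2 : kkP n a b ℓ ≤ kkP n a b ℓ * PP := Nat.le_mul_of_pos_right _ hP
    have h3 : 2 * kkP n a b ℓ * PP = 2 * (kkP n a b ℓ * PP) := by ring
    unfold repsExpP; omega
  set u := repsExpP n a b ℓ - 2 * sP n a b - 6 with hu
  have hE' : repsExpP n a b ℓ = 6 + 2 * sP n a b + u := by omega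
  have hlin : repsExpP n a b ℓ + 2 * sP n a b + 8 ≤ 2 ^ u := le_trans (by omega) (two_mul_le_two_pow u)
  unfold MP RepsP
  have hs : 64 * 4 ^ sP n a b = 2 ^ (6 + 2 * sP n a b) := by rw [pow_add, pow_mul]; norm_num
  rw [hs, hE', pow_add (2 : ℕ) (6 + 2 * sP n a b) u, ← hE']
  exact Nat.mul_le_mul_left _ hlin

/-- The run length of a processed level is inside the coins. [folklore] -/
theorem runLen_le_of_processed {R ℓ : ℕ} (h : LvlProcessedP n a b R ℓ) : lvlRunLenP n a b ℓ ≤ R ∧ RepsP n a b ℓ ≤ R ∧ MP n a b ℓ ≤ R := by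
  have hb : lvlCoffP n a b ℓ + lvlBlockLenP n a b ℓ ≤ R := by
    have := h; unfold LvlProcessedP lvlCoffP at this; rwa [Finset.sum_range_succ] at this
  have h1 : lvlRunLenP n a b ℓ ≤ lvlSlotP n a b ℓ := Nat.le_add_right _ _
  have h2 : lvlSlotP n a b ℓ ≤ RepsP n a b ℓ * lvlSlotP n a b ℓ := Nat.le_mul_of_pos_left _ (Nat.two_pow_pos _)
  have h3 : RepsP n a b ℓ ≤ RepsP n a b ℓ * lvlSlotP n a b ℓ :=
    Nat.le_mul_of_pos_right _ (by have := kP_pos n a b ℓ; unfold lvlSlotP nQRunP; omega)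
  have hM := MP_le_RepsP n a b ℓ
  unfold lvlBlockLenP at hb
  omega

end LevelCode

/-! ### The level queries with capped unary quantities -/

section Capped

variable (n a b : ℕ)

/-- **The parameter record with unary quantities capped at `R`** (exact on processed levels). [folklore] -/
def prmCapN (R ℓ : ℕ) : PrmT :=
  (n, (min (kP n a b ℓ) R, (βP n a b ℓ, (min (TP ℓ) R, (ℓ, (min (2 ^ ℓ) R, (min (QP n a b ℓ) R, (kkP n a b ℓ,
    (min (KKP n a b ℓ) R, (min (tP n a b ℓ) R, (κP n a b ℓ, (τP ℓ, (θNP n a b ℓ, θDP n a b ℓ)))))))))))))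

/-- **On a processed level the capped record is the level record.** [folklore] -/
theorem prmCapN_eq {R ℓ : ℕ} (h : LvlProcessedP n a b R ℓ) : prmCapN n a b R ℓ = prmLvl n a b ℓ := by
  obtain ⟨hk, hT, hL, hQ, hKK, ht⟩ := lvl_le_runLen n a b ℓ
  have hR := (runLen_le_of_processed n a b h).1
  rw [prmCapN, min_eq_left (hk.trans hR), min_eq_left (hT.trans hR), min_eq_left (hL.trans hR), min_eq_left (hQ.trans hR),
    min_eq_left (hKK.trans hR), min_eq_left (ht.trans hR)]
  rfl

omit P in
/-- Capping the offset of a slice at the length of the string does not change it. [folklore] -/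
theorem sl_min_length (r : List Bool) (o len : ℕ) : sl r (min o r.length) len = sl r o len := by
  rcases le_total o r.length with h | h
  · rw [min_eq_left h]
  · rw [min_eq_right h, sl, sl, List.drop_length, List.drop_eq_nil_of_le h]

variable (r : List Bool)

/-- **The level queries with capped quantities.** [folklore] -/
def lvlQueriesC (ℓ : ℕ) : List (List Bool) :=
  ((List.range (min (RepsP n a b ℓ) r.length)).map fun ρ => runQueriesN (prmCapN n a b r.length ℓ)
    (sl r (min (lvlCoffP n a b ℓ + ρ * lvlSlotP n a b ℓ) r.length) (min (lvlRunLenP n a b ℓ) r.length))).flatten ++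
  (List.range (min (MP n a b ℓ) r.length)).map fun w =>
    sl r (min (lvlCoffP n a b ℓ + RepsP n a b ℓ * lvlSlotP n a b ℓ + w * n) r.length) n

/-- **On a processed level the capped queries are the queries.** [folklore] -/
theorem lvlQueriesC_eq {ℓ : ℕ} (h : LvlProcessedP n a b r.length ℓ) : lvlQueriesC n a b r ℓ = lvlQueriesN n a b r ℓ := by
  obtain ⟨hR, hReps, hM⟩ := runLen_le_of_processed n a b h
  rw [lvlQueriesC, lvlQueriesN, prmCapN_eq n a b h, min_eq_left hReps, min_eq_left hR, min_eq_left hM]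
  simp only [sl_min_length]
  rfl

/-- All queries with capped quantities. [folklore] -/
def allQueriesC : List (List Bool) := ((List.range (nLvlsP n a b r.length)).map (lvlQueriesC n a b r)).flatten

/-- **The capped queries are the queries.** [folklore] -/
theorem allQueriesC_eq : allQueriesC n a b r = allQueriesN n a b r := by
  rw [allQueriesC, allQueriesN]
  exact congrArg List.flatten (List.map_congr_left fun ℓ hℓ =>
    lvlQueriesC_eq n a b r ((processed_iff_lt_nLvlsP n a b r.length ℓ).2 (List.mem_range.1 hℓ)))

end Capped

/-! ### The query function -/

section QueryCode

/-- The typed learner input `⟨⟨1ⁿ, ⟨1ᵃ, 1ᵇ⟩⟩, r⟩`. [folklore] -/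
abbrev LrnInT : Type := (ℕ × (ℕ × ℕ)) × List Bool

/-- Its code (`= boolPair (pacParams n a b) r`). [folklore] -/
abbrev lrnInE : LrnInT → List Bool := pairE (pairE unE (pairE unE unE)) strE

omit P in
/-- The PAC parameters are the unary triple. [folklore] -/
theorem pacParams_eq (n a b : ℕ) (r : List Bool) : boolPair (pacParams n a b) r = lrnInE ((n, (a, b)), r) := rfl

/-- `lvlCoffP` is a code. [folklore] -/
theorem coff_code : CodeFP lvlArgE natE (fun x => lvlCoffP x.1.1 x.1.2.1 x.1.2.2 x.2) := by
  have hitem : CodeFP (pairE lvlArgE natE) natE (fun s => lvlBlockLenP s.1.1.1 s.1.1.2.1 s.1.1.2.2 (min s.2 s.1.2)) :=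
    (LvlArg.blockLen_code.comp ((fst _ _).fst'.pair (uidx_code (snd _ _)))).congr fun _ => rfl
  refine ((natSum.comp ((CodeFP.map hitem).comp ((CodeFP.id _).pair (urange.comp (snd _ _))))).congr fun x => ?_)
  have h1 : ((List.range x.2).map fun ℓ' => lvlBlockLenP x.1.1 x.1.2.1 x.1.2.2 (min ℓ' x.2)) =
      (List.range x.2).map fun ℓ' => lvlBlockLenP x.1.1 x.1.2.1 x.1.2.2 ℓ' := map_range_min x.2 _
  have h2 : lvlCoffP x.1.1 x.1.2.1 x.1.2.2 x.2 = ((List.range x.2).map fun ℓ' => lvlBlockLenP x.1.1 x.1.2.1 x.1.2.2 ℓ').sum := by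
    rw [lvlCoffP, Finset.sum_range, ← List.sum_ofFn, ← map_range_eq_ofFn]
  rw [h2, ← h1]
  rfl

/-- The processedness test is a code on `⟨⟨prms, 1ᴿ⟩, ℓ⟩`. [folklore] -/
theorem processed_code : CodeFP (pairE (pairE (pairE unE (pairE unE unE)) unE) natE) bitE
    (fun s => decide (lvlCoffP s.1.1.1 s.1.1.2.1 s.1.1.2.2 (min s.2 (s.1.2 + 1) + 1) ≤ s.1.2)) := by
  have hℓ1 : CodeFP (pairE (pairE (pairE unE (pairE unE unE)) unE) natE) unE (fun s => min s.2 (s.1.2 + 1) + 1) :=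
    (unAdd.comp ((uidx_code ((unAdd.comp ((snd _ _).pair (const _ 1))).congr fun _ => rfl)).pair (const _ 1))).congr fun _ => rfl
  exact (natLe.comp ((coff_code.comp ((fst _ _).fst'.pair hℓ1)).pair (natOfUn.comp (fst _ _).snd'))).congr fun _ => rfl

/-- `nLvlsP` is a code on `⟨prms, 1ᴿ⟩`. [folklore] -/
theorem nLvls_code : CodeFP (pairE (pairE unE (pairE unE unE)) unE) unE (fun y => nLvlsP y.1.1 y.1.2.1 y.1.2.2 y.2) := by
  have hrange : CodeFP (pairE (pairE unE (pairE unE unE)) unE) (rawE natE) (fun y => List.range (y.2 + 1)) :=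
    (urange.comp ((unAdd.comp ((snd _ _).pair (const _ 1))).congr fun _ => rfl)).congr fun _ => rfl
  refine (((ulength natE).comp ((filter processed_code).comp ((CodeFP.id _).pair hrange))).congr fun y => ?_)
  simp only [nLvlsP, id]
  congr 1
  exact List.filter_congr fun ℓ hℓ => by simp only [min_eq_left (List.mem_range.1 hℓ).le]

/-- The capped record is a code on `⟨x, 1ᴿ⟩`. [folklore] -/
theorem prmCap_code : CodeFP (pairE lvlArgE unE) prmE (fun y => prmCapN y.1.1.1 y.1.1.2.1 y.1.1.2.2 y.2 y.1.2) := by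
  have hx : CodeFP (pairE lvlArgE unE) lvlArgE (fun y => y.1) := fst _ _
  have hR : CodeFP (pairE lvlArgE unE) unE (fun y => y.2) := snd _ _
  have cap : ∀ {g : LvlArgT × ℕ → ℕ}, CodeFP (pairE lvlArgE unE) natE g → CodeFP (pairE lvlArgE unE) unE (fun y => min (g y) y.2) :=
    fun hg => (unOfNatMin.comp (hR.pair hg)).congr fun _ => rfl
  have hk := cap ((LvlArg.k_code.comp hx).congr fun _ => rfl)
  have hT := cap ((LvlArg.T_code.comp hx).congr fun _ => rfl)
  have hL := cap ((LvlArg.L_code.comp hx).congr fun _ => rfl)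
  have hQ := cap ((LvlArg.Q_code.comp hx).congr fun _ => rfl)
  have hKK := cap ((LvlArg.KK_code.comp hx).congr fun _ => rfl)
  have ht := cap ((LvlArg.t_code.comp hx).congr fun _ => rfl)
  have hn : CodeFP (pairE lvlArgE unE) unE (fun y => y.1.1.1) := hx.fst'.fst'
  have hβ : CodeFP (pairE lvlArgE unE) unE (fun y => βP y.1.1.1 y.1.1.2.1 y.1.1.2.2 y.1.2) := (LvlArg.β_code.comp hx).congr fun _ => rfl
  have hℓ : CodeFP (pairE lvlArgE unE) unE (fun y => y.1.2) := hx.snd'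
  have hkk : CodeFP (pairE lvlArgE unE) unE (fun y => kkP y.1.1.1 y.1.1.2.1 y.1.1.2.2 y.1.2) := (LvlArg.kk_code.comp hx).congr fun _ => rfl
  have hκ : CodeFP (pairE lvlArgE unE) unE (fun y => κP y.1.1.1 y.1.1.2.1 y.1.1.2.2 y.1.2) := (LvlArg.κ_code.comp hx).congr fun _ => rfl
  have hτ : CodeFP (pairE lvlArgE unE) unE (fun y => τP y.1.2) := (LvlArg.τ_code.comp hx).congr fun _ => rfl
  have hθN : CodeFP (pairE lvlArgE unE) natE (fun y => θNP y.1.1.1 y.1.1.2.1 y.1.1.2.2 y.1.2) := (LvlArg.θN_code.comp hx).congr fun _ => rfl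
  have hθD : CodeFP (pairE lvlArgE unE) natE (fun y => θDP y.1.1.1 y.1.1.2.1 y.1.1.2.2 y.1.2) := (LvlArg.θD_code.comp hx).congr fun _ => rfl
  exact (hn.pair (hk.pair (hβ.pair (hT.pair (hℓ.pair (hL.pair (hQ.pair (hkk.pair (hKK.pair (ht.pair (hκ.pair (hτ.pair (hθN.pair hθD))))))))))))).congr
    fun _ => rfl

/-- The typed argument `⟨⟨prms, r⟩, ℓ⟩` of the level queries. [folklore] -/
abbrev LvlQT : Type := LrnInT × ℕ

/-- Its code. [folklore] -/
abbrev lvlQE : LvlQT → List Bool := pairE lrnInE natE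

/-- **`lvlQueriesC` is a code** on `⟨⟨prms, r⟩, ℓ⟩` (`ℓ` in binary, below `|r| + 1`). [folklore] -/
theorem lvlQueriesC_code : CodeFP lvlQE (rawE strE) (fun y => lvlQueriesC y.1.1.1 y.1.1.2.1 y.1.1.2.2 y.1.2 (min y.2 y.1.2.length)) := by
  have hr : CodeFP lvlQE strE (fun y => y.1.2) := (fst _ _).snd'
  have hR : CodeFP lvlQE unE (fun y => y.1.2.length) := (strLength.comp hr).congr fun _ => rfl
  have hℓ : CodeFP lvlQE unE (fun y => min y.2 y.1.2.length) := (unOfNatMin.comp (hR.pair (snd _ _))).congr fun _ => rfl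
  have hx : CodeFP lvlQE lvlArgE (fun y => (y.1.1, min y.2 y.1.2.length)) := ((fst _ _).fst'.pair hℓ).congr fun _ => rfl
  have hn : CodeFP lvlQE unE (fun y => y.1.1.1) := (fst _ _).fst'.fst'
  have hπ : CodeFP lvlQE prmE (fun y => prmCapN y.1.1.1 y.1.1.2.1 y.1.1.2.2 y.1.2.length (min y.2 y.1.2.length)) :=
    (prmCap_code.comp (hx.pair hR)).congr fun _ => rfl
  have hcoff : CodeFP lvlQE natE (fun y => lvlCoffP y.1.1.1 y.1.1.2.1 y.1.1.2.2 (min y.2 y.1.2.length)) := (coff_code.comp hx).congr fun _ => rfl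
  have hReps : CodeFP lvlQE natE (fun y => RepsP y.1.1.1 y.1.1.2.1 y.1.1.2.2 (min y.2 y.1.2.length)) := (LvlArg.Reps_code.comp hx).congr fun _ => rfl
  have hslot : CodeFP lvlQE natE (fun y => lvlSlotP y.1.1.1 y.1.1.2.1 y.1.1.2.2 (min y.2 y.1.2.length)) := (LvlArg.slot_code.comp hx).congr fun _ => rfl
  have hRepsU : CodeFP lvlQE unE (fun y => min (RepsP y.1.1.1 y.1.1.2.1 y.1.1.2.2 (min y.2 y.1.2.length)) y.1.2.length) :=
    (unOfNatMin.comp (hR.pair hReps)).congr fun _ => rfl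
  have hrunU : CodeFP lvlQE unE (fun y => min (lvlRunLenP y.1.1.1 y.1.1.2.1 y.1.1.2.2 (min y.2 y.1.2.length)) y.1.2.length) :=
    (unOfNatMin.comp (hR.pair ((LvlArg.runLen_code.comp hx).congr fun _ => rfl))).congr fun _ => rfl
  have hMU : CodeFP lvlQE unE (fun y => min (MP y.1.1.1 y.1.1.2.1 y.1.1.2.2 (min y.2 y.1.2.length)) y.1.2.length) :=
    (unOfNatMin.comp (hR.pair ((LvlArg.M_code.comp hx).congr fun _ => rfl))).congr fun _ => rfl
  -- the runs: context `y`, item `ρ`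
  have hoff : CodeFP (pairE lvlQE natE) unE (fun s => min (lvlCoffP s.1.1.1.1 s.1.1.1.2.1 s.1.1.1.2.2 (min s.1.2 s.1.1.2.length) +
      s.2 * lvlSlotP s.1.1.1.1 s.1.1.1.2.1 s.1.1.1.2.2 (min s.1.2 s.1.1.2.length)) s.1.1.2.length) :=
    (unOfNatMin.comp ((hR.comp (fst _ _)).pair (natAdd.comp ((hcoff.comp (fst _ _)).pair (natMul.comp ((snd _ _).pair (hslot.comp (fst _ _)))))))).congr
      fun _ => rfl
  have hseg : CodeFP (pairE lvlQE natE) strE (fun s => sl s.1.1.2 (min (lvlCoffP s.1.1.1.1 s.1.1.1.2.1 s.1.1.1.2.2 (min s.1.2 s.1.1.2.length) +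
      s.2 * lvlSlotP s.1.1.1.1 s.1.1.1.2.1 s.1.1.1.2.2 (min s.1.2 s.1.1.2.length)) s.1.1.2.length)
      (min (lvlRunLenP s.1.1.1.1 s.1.1.1.2.1 s.1.1.1.2.2 (min s.1.2 s.1.1.2.length)) s.1.1.2.length)) :=
    (sl_code hoff ((hrunU.comp (fst _ _)).congr fun _ => rfl) ((hr.comp (fst _ _)).congr fun _ => rfl)).congr fun _ => rfl
  have hπ1 : CodeFP (pairE lvlQE natE) prmE (fun s => prmCapN s.1.1.1.1 s.1.1.1.2.1 s.1.1.1.2.2 s.1.1.2.length (min s.1.2 s.1.1.2.length)) :=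
    (hπ.comp (fst _ _)).congr fun _ => rfl
  have hrun : CodeFP (pairE lvlQE natE) (rawE strE) (fun s => runQueriesN (prmCapN s.1.1.1.1 s.1.1.1.2.1 s.1.1.1.2.2 s.1.1.2.length (min s.1.2 s.1.1.2.length))
      (sl s.1.1.2 (min (lvlCoffP s.1.1.1.1 s.1.1.1.2.1 s.1.1.1.2.2 (min s.1.2 s.1.1.2.length) +
        s.2 * lvlSlotP s.1.1.1.1 s.1.1.1.2.1 s.1.1.1.2.2 (min s.1.2 s.1.1.2.length)) s.1.1.2.length)
        (min (lvlRunLenP s.1.1.1.1 s.1.1.1.2.1 s.1.1.1.2.2 (min s.1.2 s.1.1.2.length)) s.1.1.2.length))) :=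
    (runQueries_code.comp (hπ1.pair hseg)).congr fun _ => rfl
  have hruns := (flatten strE).comp ((CodeFP.map hrun).comp ((CodeFP.id _).pair (urange.comp hRepsU)))
  -- the validation points: item `w`
  have hReps1 : CodeFP (pairE lvlQE natE) natE (fun s => RepsP s.1.1.1.1 s.1.1.1.2.1 s.1.1.1.2.2 (min s.1.2 s.1.1.2.length)) := (hReps.comp (fst _ _)).congr fun _ => rfl
  have hslot1 : CodeFP (pairE lvlQE natE) natE (fun s => lvlSlotP s.1.1.1.1 s.1.1.1.2.1 s.1.1.1.2.2 (min s.1.2 s.1.1.2.length)) := (hslot.comp (fst _ _)).congr fun _ => rfl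
  have hcoff1 : CodeFP (pairE lvlQE natE) natE (fun s => lvlCoffP s.1.1.1.1 s.1.1.1.2.1 s.1.1.1.2.2 (min s.1.2 s.1.1.2.length)) := (hcoff.comp (fst _ _)).congr fun _ => rfl
  have hn1 : CodeFP (pairE lvlQE natE) unE (fun s => s.1.1.1.1) := (hn.comp (fst _ _)).congr fun _ => rfl
  have hR1 : CodeFP (pairE lvlQE natE) unE (fun s => s.1.1.2.length) := (hR.comp (fst _ _)).congr fun _ => rfl
  have hr1 : CodeFP (pairE lvlQE natE) strE (fun s => s.1.1.2) := (hr.comp (fst _ _)).congr fun _ => rfl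
  have hvoffN : CodeFP (pairE lvlQE natE) natE (fun s => lvlCoffP s.1.1.1.1 s.1.1.1.2.1 s.1.1.1.2.2 (min s.1.2 s.1.1.2.length) +
      RepsP s.1.1.1.1 s.1.1.1.2.1 s.1.1.1.2.2 (min s.1.2 s.1.1.2.length) * lvlSlotP s.1.1.1.1 s.1.1.1.2.1 s.1.1.1.2.2 (min s.1.2 s.1.1.2.length) +
      s.2 * s.1.1.1.1) :=
    (natAdd.comp ((natAdd.comp (hcoff1.pair (natMul.comp (hReps1.pair hslot1)))).pair (natMul.comp ((snd _ _).pair (natOfUn.comp hn1))))).congr fun _ => rfl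
  have hvoff : CodeFP (pairE lvlQE natE) unE (fun s => min (lvlCoffP s.1.1.1.1 s.1.1.1.2.1 s.1.1.1.2.2 (min s.1.2 s.1.1.2.length) +
      RepsP s.1.1.1.1 s.1.1.1.2.1 s.1.1.1.2.2 (min s.1.2 s.1.1.2.length) * lvlSlotP s.1.1.1.1 s.1.1.1.2.1 s.1.1.1.2.2 (min s.1.2 s.1.1.2.length) +
      s.2 * s.1.1.1.1) s.1.1.2.length) := (unOfNatMin.comp (hR1.pair hvoffN)).congr fun _ => rfl
  have hval := sl_code hvoff hn1 hr1
  have hvals := (CodeFP.map hval).comp ((CodeFP.id _).pair (urange.comp hMU))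
  exact ((rawAppend strE).comp (hruns.pair hvals)).congr fun y => by simp only [id, lvlQueriesC]

/-- **`allQueriesC` is a code** on the learner input. [folklore] -/
theorem allQueriesC_code : CodeFP lrnInE (rawE strE) (fun z => allQueriesC z.1.1 z.1.2.1 z.1.2.2 z.2) := by
  have hn : CodeFP lrnInE unE (fun z => nLvlsP z.1.1 z.1.2.1 z.1.2.2 z.2.length) :=
    (nLvls_code.comp ((fst _ _).pair ((strLength.comp (snd _ _)).congr fun _ => rfl))).congr fun _ => rfl
  refine (((flatten strE).comp ((CodeFP.map lvlQueriesC_code).comp ((CodeFP.id _).pair (urange.comp hn)))).congr fun z => ?_)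
  simp only [allQueriesC, id]
  refine congrArg List.flatten (List.map_congr_left fun ℓ hℓ => ?_)
  have hlt := List.mem_range.1 hℓ
  have hle : ℓ ≤ z.2.length := (lt_of_processed z.1.1 z.1.2.1 z.1.2.2 ((processed_iff_lt_nLvlsP _ _ _ _ ℓ).2 hlt)).le
  simp only [min_eq_left hle]

/-- **The query code**: `⟨x, 1ⁱ⟩ ↦ queryAtN i`. [folklore] -/
theorem queryAt_code : CodeFP (pairE lrnInE unE) strE (fun w => queryAtN w.1.1.1 w.1.1.2.1 w.1.1.2.2 w.1.2 w.2) := by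
  refine (((rawGetOr strE).comp ((allQueriesC_code.comp (fst _ _)).pair ((natOfUn.comp (snd _ _)).pair
    (MachineA.falses_code.comp (fst _ _).fst'.fst')))).congr fun w => ?_)
  simp only [queryAtN, allQueriesC_eq, id]

/-- **The query function of the `AC⁰[p]` learner**: `⟨x, 1ⁱ⟩ ↦ true :: yᵢ` (a membership query). [cite: KearnsVazirani1994, §8.1] -/
noncomputable def qPFn : List Bool → List Bool := List.cons true ∘ Classical.choose queryAt_code

/-- `qPFn ∈ FP`. [folklore] -/
theorem qPFn_mem_FP : qPFn ∈ FP := comp_mem_FP (cons_mem_FP true) (Classical.choose_spec queryAt_code).1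

omit P in
/-- `1ⁱ` is the unary numeral. [folklore] -/
theorem replicate_true_eq_unE (i : ℕ) : List.replicate i true = unE i := by
  induction i with
  | zero => rfl
  | succ i ih => rw [List.replicate_succ, ih]; rfl

/-- **Value of `qPFn`**: the `i`-th scheduled membership query. [folklore] -/
theorem qPFn_apply (n a b : ℕ) (r : List Bool) (i : ℕ) :
    qPFn (boolPair (boolPair (pacParams n a b) r) (List.replicate i true)) = true :: queryAtN n a b r i := by
  have h := (Classical.choose_spec queryAt_code).2 (((n, (a, b)), r), i)
  rw [qPFn, Function.comp_apply, pacParams_eq, replicate_true_eq_unE, show boolPair (lrnInE ((n, (a, b)), r)) (unE i) =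
    pairE lrnInE unE (((n, (a, b)), r), i) from rfl, h]
  rfl

end QueryCode

end Modp

end Literature.Computability.Learning
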